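import Literature.NumberTheory.Rogawski1990.ArchimedeanTransfer          -- ★ `archStableOrbitalIntegral`, `IsArchInnerTransfer` (14.2.1) on the `arch` carriers
import Literature.NumberTheory.Rogawski1990.LocalTransferTransport       -- ★ `OrbitalMeasureFamily.transport`, `classOrbitalIntegral_transport`, `stableOrbitalIntegralRel_transport`
import Literature.NumberTheory.Rogawski1990.LocalTransferCongruence      -- ★ `isStablyConj_iff_of_corresponds`, `isRegularElt_iff_of_corresponds`
import Literature.NumberTheory.Automorphic.UnitaryGroupArchTopology      -- ★ instances: `arch` is locally compact, second countable, Hausdorff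
import HarnessLib

/-!
# The archimedean congruence transport, ORBITAL-INTEGRAL half: stable orbital integrals `Φ^st(γ, f_∞)` and the inner-transfer relation (14.2.1)
# on `U(H)(L ⊗ ℝ)` are invariant under `g ↦ T g T⁻¹ : U(H₂)(L ⊗ ℝ) ≃ₜ* U(H)(L ⊗ ℝ)` with the transported («compatible») orbital measures
(ROAD-Sd (T-d), FILE 2; Rogawski 1990 §14.2 (14.2.1) p. 232, §14.4 p. 237 «`f_v = f′_v ∘ ψ_v⁻¹`», §1.7 p. 6; Gelbart 1975 §10 pp. 154–155)

Topic `NumberTheory/Rogawski1990`; namespace `Literature.NumberTheory.Rogawski1990` (§1 generic in its `Transport` vocabulary; §2–§3 the `arch` readings).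
THEOREMS ONLY (no `def`, no instance, no notation, no axiom, no named fact, no `sorry`).  Cell `pub/hodgecm-mathlib`, ENGINE T1 (crux H413 =
`stmt-HodgeConjecture-24833`); floor-1 preparation, count-neutral, under books rows #88 (ST-∞) ∕ #111 (S-d): ROAD-Sd item (T-d) «CONGRUENCE TRANSPORT», the (L-use)∕(L-st)
junction's reading of its torus-side statements on the closer's carriers (LEAD DESK WORDS T8-39 ∕ T8-42, F0P3a-plan (g9), 2026-09-01; census
`CENSUS-Td-CongruenceTransport.F0P3a-p02g10.md` 9b2b941dccae668a; memo of record F0P3a-p06 (g9) `ROAD-Sd-3prime-congruence` item (c)(v)); author F0P3a-p02 (g10).  Sequel of FILE 1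
`Automorphic/ArchCongruenceOrbitalTransport` (functions, singular orbital integrals, per-place factors, the quasi-split datum `Φ₃ = c(Q)ᵀ·diag(½,1,−½)·Q`); independent of it.

WHY.  The closer's archimedean statements quantify over `G′_∞ = U(H′)(L ⊗ ℝ)` for an ARBITRARY hermitian anisotropic `H′` and over the quasi-split `G_∞ = U(Φ₃)(L ⊗ ℝ)` (hard-wired in ★
`IsArchInnerTransfer` and in (ST-∞)∕`stub_Sc`∕`stub_Sd`), through the stable orbital integrals ★ `archStableOrbitalIntegral L N H m a γ` (stable conjugacy = `GL_N(L ⊗ ℝ)`-conjugacy, ★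
`IsStablyConj (c ⊗ 1) (H ⊗ 1)`) and the relation (14.2.1) ★ `IsArchInnerTransfer L H′ m′ m a′ a`.  The torus side (J1, (J-nc), (V2)–(V9), (J-sgn)) lives on `U(diag β)(L ⊗ ℝ)`.  A congruence
`H₂ = c(P)ᵀ H P` gives `Φ_P : U(H₂)(L ⊗ ℝ) ≃ₜ* U(H)(L ⊗ ℝ)`, `g ↦ (P ⊗ 1) g (P ⊗ 1)⁻¹` (★ p06 `ArchCongruenceTransport`); since `Φ_P` is an AMBIENT conjugation it preserves stable classes,
regularity and correspondences, so — with the TRANSPORTED family `Φ_* m` (★ `OrbitalMeasureFamily.transport`: print's «compatible measures» [Rogawski1990 §1.7 p. 6]) and the transported test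
function `a ∘ Φ⁻¹` («`f_v = f′_v ∘ ψ_v⁻¹`» [§14.4 p. 237]) — stable orbital integrals and (14.2.1) are carried over VERBATIM.  Everything is stated for an ABSTRACT `Φ` acting by
`g ↦ T g T⁻¹` (hypothesis `hΦ`), discharged by `rfl` for the tree's term (FILE 1 `coe_archCongrOfEq_apply`).

WHAT IS PROVED.
* §1 GENERIC (★ `IsInnerTransferRel corr stB stA regA m′ m f′ f`, ★ `stableOrbitalIntegralRel`): **`isInnerTransferRel_transport_left_iff`** — reparametrising the SOURCE group along a
  bicontinuous `ψ : B₂ ≃* B` intertwining the stable conjugacies: `IsInnerTransferRel corr stB stA regA (ψ_* m₂) m (f₂ ∘ ψ⁻¹) f ↔ IsInnerTransferRel (corr ∘ ψ) stB₂ stA regA m₂ m f₂ f`;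
  **`stableOrbitalIntegralRel_transport_eq_of_isInnerTransferRel`** — reading the TARGET side through a bicontinuous `φ : A ≃* A₂`: `Φ^st_{A₂}(φ a, f ∘ φ⁻¹; φ_* m) = Φ^st_B(b, f′; m′)`
  whenever `corr b a`, `regA a` (★ `stableOrbitalIntegralRel_transport`).
* §2 ARCH, along `Φ : U(H₂)(L ⊗ ℝ) ≃ₜ* U(H)(L ⊗ ℝ)` with `hΦ`: `isConj_coe_archCongr`, `corresponds_archCongr_self` (`g ↔ Φ g`), `isStablyConj_archCongr_iff`, `corresponds_archCongr_left_iff` ∕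
  `corresponds_archCongr_right_iff`, `isRegularElt_coe_archCongr_iff`; **`archStableOrbitalIntegral_transport_archCongr`**: `Φ^st_H(Φ γ, a ∘ Φ⁻¹; Φ_* m) = Φ^st_{H₂}(γ, a; m)` (any `N`).
* §3 (14.2.1) (`N = 3`): **`isArchInnerTransfer_transport_left_iff`** — on the INNER-FORM side, `IsArchInnerTransfer L H (Φ_* m₂) m (a₂ ∘ Φ⁻¹) a ↔ IsArchInnerTransfer L H₂ m₂ m a₂ a` (ARCH twin
  of ★ `isLocalInnerTransfer_transport` ∕ `isInnerTransferRel_cmLocal_transport`); on the QUASI-SPLIT side — where (14.2.1) has `Φ₃` FIXED, so a transport is a READING, not an `↔` of the named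
  relation — **`archStableOrbitalIntegral_transport_eq_of_isArchInnerTransfer`**: for any `Φ_A : U(Φ₃)(L ⊗ ℝ) ≃ₜ* U(H_A)(L ⊗ ℝ)` acting by conjugation (e.g. FILE 1's `Φ_Q⁻¹`-direction term onto
  `U(diag(½,1,−½))`), `IsArchInnerTransfer L H′ m′ m a′ a`, `δ ∈ U(H_A)` regular and `γ′ ↔ δ` give `Φ^st_{H_A}(δ, a ∘ Φ_A⁻¹; (Φ_A)_* m) = Φ^st_{H′}(γ′, a′; m′)` — the two stable orbital
  integrals the (L-use) junction differentiates, both now on DIAGONAL-form carriers when `H_A = diag β` and `H′ = diag α′`.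
NOT HERE: Kottwitz signs ∕ `archKappaOrbitalIntegral` under `Φ` (FILE 3, over ★ `kottwitzSign_congr` and p05's ★ `KottwitzSignArchTorus`), `ArchSmooth (a ∘ Φ⁻¹)` (memo (d)), the Δ-side
(`IsArchNormPair`, ★ `TransferFactorData.comap`; memo (b), on a word).  HONEST LABEL: HC_CM is proved only modulo the printed citations until rung 0 closes; this file is bookkeeping and pays
nothing by itself.

## References
* [Rogawski1990] J. D. Rogawski, *Automorphic Representations of Unitary Groups in Three Variables*, Ann. of Math. Stud. 123 (1990), §14.2 (14.2.1) p. 232, §14.4 p. 237 («we use `ψ_v` to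
  identify `G′_v` with `G_v` … `f_v = f′_v ∘ ψ_v⁻¹`»), §1.7 p. 6 («compatible measures»), §4.1 (4.1.1) p. 39, §3.1–3.2 p. 19 (stable conjugacy, `γ′ ↔ γ`).
* [Gelbart1975] S. Gelbart, *Automorphic Forms on Adele Groups*, Ann. of Math. Stud. 83 (1975), §10 pp. 154–155 (orbital integrals matched class by class along `G_S = G′_S`).
* [PlatonovRapinchuk1994] V. Platonov, A. Rapinchuk, *Algebraic Groups and Number Theory* (1994), §2.3 (equivalent hermitian forms have conjugate unitary groups).
-/

set_option autoImplicit false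

noncomputable section

open MeasureTheory NumberField NumberField.InfinitePlace NumberField.mixedEmbedding Topology
open scoped Matrix MatrixGroups

namespace Literature.NumberTheory.Rogawski1990

open Literature.MeasureTheory.Group Literature.NumberTheory.Automorphic
open Literature.AlgebraicGeometry.ShimuraVarieties (unitaryGroup)

/-! ## §1 Generic: (14.2.1) under reparametrisation of either side -/

section Generic

variable {A B B₂ : Type*} [Group A] [Group B] [Group B₂] [TopologicalSpace B] [TopologicalSpace B₂] [IsTopologicalGroup B]
  [∀ a : A, MeasurableSpace (A ⧸ Subgroup.centralizer ({a} : Set A))]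
  [∀ b : B, MeasurableSpace (B ⧸ Subgroup.centralizer ({b} : Set B))] [∀ b : B, BorelSpace (B ⧸ Subgroup.centralizer ({b} : Set B))]
  [∀ b : B₂, MeasurableSpace (B₂ ⧸ Subgroup.centralizer ({b} : Set B₂))] [∀ b : B₂, BorelSpace (B₂ ⧸ Subgroup.centralizer ({b} : Set B₂))]
  (ψ : B₂ ≃* B) (hψ : Continuous ψ) (hψs : Continuous ψ.symm)

/-- **(14.2.1) under reparametrisation of the SOURCE group**: for a bicontinuous `ψ : B₂ ≃* B` intertwining the stable conjugacies (`stB₂ b b′ ↔ stB (ψb) (ψb′)`, both class functions in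
the second variable), the relation for `(ψ_* m₂, f₂ ∘ ψ⁻¹)` against the correspondence `corr` on `B` IS the relation for `(m₂, f₂)` against `corr ∘ ψ` on `B₂` — because
`Φ^st_B(ψ b, f₂ ∘ ψ⁻¹; ψ_* m₂) = Φ^st_{B₂}(b, f₂; m₂)` (★ `stableOrbitalIntegralRel_transport`) and `ψ` is onto. [cite: Rogawski1990, §14.2 (14.2.1) p. 232] [cite: Gelbart1975, §10 pp. 154–155] -/
theorem isInnerTransferRel_transport_left_iff (corr : B → A → Prop) (stB : B → B → Prop) (stB₂ : B₂ → B₂ → Prop) (stA : A → A → Prop)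
    (regA : A → Prop) (hst : ∀ b b', stB₂ b b' ↔ stB (ψ b) (ψ b')) (hB : ∀ b y y', IsConj y y' → (stB b y ↔ stB b y'))
    (hB₂ : ∀ b y y', IsConj y y' → (stB₂ b y ↔ stB₂ b y')) (m₂ : OrbitalMeasureFamily B₂) (m : OrbitalMeasureFamily A) (f₂ : B₂ → ℂ) (f : A → ℂ) :
    IsInnerTransferRel corr stB stA regA (m₂.transport ψ hψ hψs) m (f₂ ∘ ψ.symm) f ↔
      IsInnerTransferRel (fun b₂ a => corr (ψ b₂) a) stB₂ stA regA m₂ m f₂ f := by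
  have key : ∀ b₂ : B₂, stableOrbitalIntegralRel stB (m₂.transport ψ hψ hψs) (f₂ ∘ ψ.symm) (ψ b₂) = stableOrbitalIntegralRel stB₂ m₂ f₂ b₂ := fun b₂ => by
    have h := stableOrbitalIntegralRel_transport ψ hψ hψs stB stB₂ hst hB hB₂ m₂ (f₂ ∘ ψ.symm) b₂
    have hcomp : (f₂ ∘ ψ.symm) ∘ (ψ : B₂ → B) = f₂ := funext fun b => by
      show f₂ (ψ.symm (ψ b)) = f₂ b
      rw [MulEquiv.symm_apply_apply]
    rw [hcomp] at h
    exact h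
  unfold IsInnerTransferRel
  refine forall_congr' fun a => forall_congr' fun _ => and_congr ⟨fun h b₂ hc => ?_, fun h b hc => ?_⟩ ⟨fun h hno => ?_, fun h hno => ?_⟩
  · rw [← key]
    exact h (ψ b₂) hc
  · obtain ⟨b₂, rfl⟩ := ψ.surjective b
    rw [key]
    exact h b₂ hc
  · exact h fun b hc => by
      obtain ⟨b₂, rfl⟩ := ψ.surjective b
      exact hno b₂ hc
  · exact h fun b₂ hc => hno (ψ b₂) hc

variable {A₂ : Type*} [Group A₂] [TopologicalSpace A] [TopologicalSpace A₂] [IsTopologicalGroup A₂]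
  [∀ a : A, BorelSpace (A ⧸ Subgroup.centralizer ({a} : Set A))]
  [∀ a : A₂, MeasurableSpace (A₂ ⧸ Subgroup.centralizer ({a} : Set A₂))] [∀ a : A₂, BorelSpace (A₂ ⧸ Subgroup.centralizer ({a} : Set A₂))]
  (φ : A ≃* A₂) (hφ : Continuous φ) (hφs : Continuous φ.symm)

omit [TopologicalSpace B] [TopologicalSpace B₂] [IsTopologicalGroup B]
  [∀ b : B, BorelSpace (B ⧸ Subgroup.centralizer ({b} : Set B))]
  [∀ b : B₂, MeasurableSpace (B₂ ⧸ Subgroup.centralizer ({b} : Set B₂))] [∀ b : B₂, BorelSpace (B₂ ⧸ Subgroup.centralizer ({b} : Set B₂))] in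
/-- **Reading (14.2.1) on a reparametrised TARGET group**: for a bicontinuous `φ : A ≃* A₂` intertwining `stA`, `stA₂` (class functions in the second variable), if
`IsInnerTransferRel corr stB stA regA m′ m f′ f` then at every `regA`-regular `a` and every `b` with `corr b a`,
`Φ^st_{A₂}(φ a, f ∘ φ⁻¹; φ_* m) = Φ^st_B(b, f′; m′)`. [cite: Rogawski1990, §14.2 (14.2.1) p. 232] [cite: Gelbart1975, §10 pp. 154–155] -/
theorem stableOrbitalIntegralRel_transport_eq_of_isInnerTransferRel {corr : B → A → Prop} {stB : B → B → Prop} {stA : A → A → Prop}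
    {regA : A → Prop} (stA₂ : A₂ → A₂ → Prop) (hst : ∀ a a', stA a a' ↔ stA₂ (φ a) (φ a')) (hA : ∀ a y y', IsConj y y' → (stA a y ↔ stA a y'))
    (hA₂ : ∀ a y y', IsConj y y' → (stA₂ a y ↔ stA₂ a y')) {m' : OrbitalMeasureFamily B} {m : OrbitalMeasureFamily A} {f' : B → ℂ} {f : A → ℂ}
    (h : IsInnerTransferRel corr stB stA regA m' m f' f) {a : A} (ha : regA a) {b : B} (hb : corr b a) :
    stableOrbitalIntegralRel stA₂ (m.transport φ hφ hφs) (f ∘ φ.symm) (φ a) = stableOrbitalIntegralRel stB m' f' b := by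
  have ht := stableOrbitalIntegralRel_transport φ hφ hφs stA₂ stA hst hA₂ hA m (f ∘ φ.symm) a
  have hcomp : (f ∘ φ.symm) ∘ (φ : A → A₂) = f := funext fun x => by
    show f (φ.symm (φ x)) = f x
    rw [MulEquiv.symm_apply_apply]
  rw [hcomp] at ht
  rw [ht]
  exact (h a ha).1 b hb

end Generic

/-! ## §2 The arch readings: stable classes, correspondences, regularity and `Φ^st` under `g ↦ T g T⁻¹` -/

section Arch

variable (L : Type) [Field L] [NumberField L] [IsCMField L] {N : ℕ} {H H₂ : Matrix (Fin N) (Fin N) L} (T : GL (Fin N) (mixedSpace L))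
  (Φ : UnitaryGroup.arch (↥(maximalRealSubfield L)) L (IsCMField.complexConj L) N H₂ ≃ₜ* UnitaryGroup.arch (↥(maximalRealSubfield L)) L (IsCMField.complexConj L) N H)
  (hΦ : ∀ g : UnitaryGroup.arch (↥(maximalRealSubfield L)) L (IsCMField.complexConj L) N H₂,
    ((Φ g : UnitaryGroup.arch (↥(maximalRealSubfield L)) L (IsCMField.complexConj L) N H) : GL (Fin N) (mixedSpace L)) = T * (g : GL (Fin N) (mixedSpace L)) * T⁻¹)

include hΦ in
/-- `g` and `Φ g = T g T⁻¹` are conjugate in `GL_N(L ⊗ ℝ)`. [cite: PlatonovRapinchuk1994, §2.3] -/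
theorem isConj_coe_archCongr (g : UnitaryGroup.arch (↥(maximalRealSubfield L)) L (IsCMField.complexConj L) N H₂) :
    IsConj (g : GL (Fin N) (mixedSpace L)) ((Φ g : UnitaryGroup.arch (↥(maximalRealSubfield L)) L (IsCMField.complexConj L) N H) : GL (Fin N) (mixedSpace L)) :=
  isConj_iff.2 ⟨T, (hΦ g).symm⟩

include hΦ in
/-- **`Φ` IS CLASS-PRESERVING**: `g ↔ Φ g` (★ `Corresponds (c ⊗ 1) (H₂ ⊗ 1) (H ⊗ 1)` = conjugacy in the common `GL_N(L ⊗ ℝ)`). [cite: Rogawski1990, §14.1 p. 232; §14.4 p. 237] -/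
theorem corresponds_archCongr_self (g : UnitaryGroup.arch (↥(maximalRealSubfield L)) L (IsCMField.complexConj L) N H₂) :
    Corresponds (UnitaryGroup.conjMixed (↥(maximalRealSubfield L)) L (IsCMField.complexConj L)) (UnitaryGroup.archFormOf L N H₂) (UnitaryGroup.archFormOf L N H)
      g (Φ g) :=
  isConj_coe_archCongr L T Φ hΦ g

include hΦ in
/-- **STABLE CONJUGACY IS CARRIED BY `Φ`**: `Φ x ∼_st Φ y ↔ x ∼_st y`. [cite: Rogawski1990, §3.1 p. 19; §14.2 p. 232] -/
theorem isStablyConj_archCongr_iff (x y : UnitaryGroup.arch (↥(maximalRealSubfield L)) L (IsCMField.complexConj L) N H₂) :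
    IsStablyConj (UnitaryGroup.conjMixed (↥(maximalRealSubfield L)) L (IsCMField.complexConj L)) (UnitaryGroup.archFormOf L N H) (Φ x) (Φ y) ↔
      IsStablyConj (UnitaryGroup.conjMixed (↥(maximalRealSubfield L)) L (IsCMField.complexConj L)) (UnitaryGroup.archFormOf L N H₂) x y :=
  (isStablyConj_iff_of_corresponds (σ := UnitaryGroup.conjMixed (↥(maximalRealSubfield L)) L (IsCMField.complexConj L))
    (H' := UnitaryGroup.archFormOf L N H₂) (H := UnitaryGroup.archFormOf L N H) Φ (corresponds_archCongr_self L T Φ hΦ) x y).symm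

include hΦ in
/-- Correspondences INTO a third group are carried by `Φ` on the left: `Φ g ↔ a` iff `g ↔ a`. [cite: Rogawski1990, §14.1 p. 232] -/
theorem corresponds_archCongr_left_iff {N' : Matrix (Fin N) (Fin N) L} (g : UnitaryGroup.arch (↥(maximalRealSubfield L)) L (IsCMField.complexConj L) N H₂)
    (a : UnitaryGroup.arch (↥(maximalRealSubfield L)) L (IsCMField.complexConj L) N N') :
    Corresponds (UnitaryGroup.conjMixed (↥(maximalRealSubfield L)) L (IsCMField.complexConj L)) (UnitaryGroup.archFormOf L N H) (UnitaryGroup.archFormOf L N N') (Φ g) a ↔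
      Corresponds (UnitaryGroup.conjMixed (↥(maximalRealSubfield L)) L (IsCMField.complexConj L)) (UnitaryGroup.archFormOf L N H₂) (UnitaryGroup.archFormOf L N N') g a :=
  ⟨fun h => (isConj_coe_archCongr L T Φ hΦ g).trans h, fun h => (isConj_coe_archCongr L T Φ hΦ g).symm.trans h⟩

include hΦ in
/-- … and on the right: `a ↔ Φ g` iff `a ↔ g`. [cite: Rogawski1990, §14.1 p. 232] -/
theorem corresponds_archCongr_right_iff {N' : Matrix (Fin N) (Fin N) L} (a : UnitaryGroup.arch (↥(maximalRealSubfield L)) L (IsCMField.complexConj L) N N')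
    (g : UnitaryGroup.arch (↥(maximalRealSubfield L)) L (IsCMField.complexConj L) N H₂) :
    Corresponds (UnitaryGroup.conjMixed (↥(maximalRealSubfield L)) L (IsCMField.complexConj L)) (UnitaryGroup.archFormOf L N N') (UnitaryGroup.archFormOf L N H) a (Φ g) ↔
      Corresponds (UnitaryGroup.conjMixed (↥(maximalRealSubfield L)) L (IsCMField.complexConj L)) (UnitaryGroup.archFormOf L N N') (UnitaryGroup.archFormOf L N H₂) a g :=
  ⟨fun h => h.trans (isConj_coe_archCongr L T Φ hΦ g).symm, fun h => h.trans (isConj_coe_archCongr L T Φ hΦ g)⟩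

include hΦ in
/-- **REGULARITY IS CARRIED BY `Φ`** (separability of the characteristic polynomial is a class function, ★ `isRegularElt_conj_iff`). [cite: Rogawski1990, §3.1 p. 19] -/
theorem isRegularElt_coe_archCongr_iff (g : UnitaryGroup.arch (↥(maximalRealSubfield L)) L (IsCMField.complexConj L) N H₂) :
    IsRegularElt ((Φ g : UnitaryGroup.arch (↥(maximalRealSubfield L)) L (IsCMField.complexConj L) N H) : GL (Fin N) (mixedSpace L)) ↔
      IsRegularElt (g : GL (Fin N) (mixedSpace L)) := by
  rw [hΦ g]
  exact isRegularElt_conj_iff T _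

variable
  [∀ γ : UnitaryGroup.arch (↥(maximalRealSubfield L)) L (IsCMField.complexConj L) N H,
    MeasurableSpace (UnitaryGroup.arch (↥(maximalRealSubfield L)) L (IsCMField.complexConj L) N H ⧸
      Subgroup.centralizer ({γ} : Set (UnitaryGroup.arch (↥(maximalRealSubfield L)) L (IsCMField.complexConj L) N H)))]
  [∀ γ : UnitaryGroup.arch (↥(maximalRealSubfield L)) L (IsCMField.complexConj L) N H,
    BorelSpace (UnitaryGroup.arch (↥(maximalRealSubfield L)) L (IsCMField.complexConj L) N H ⧸
      Subgroup.centralizer ({γ} : Set (UnitaryGroup.arch (↥(maximalRealSubfield L)) L (IsCMField.complexConj L) N H)))]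
  [∀ γ : UnitaryGroup.arch (↥(maximalRealSubfield L)) L (IsCMField.complexConj L) N H₂,
    MeasurableSpace (UnitaryGroup.arch (↥(maximalRealSubfield L)) L (IsCMField.complexConj L) N H₂ ⧸
      Subgroup.centralizer ({γ} : Set (UnitaryGroup.arch (↥(maximalRealSubfield L)) L (IsCMField.complexConj L) N H₂)))]
  [∀ γ : UnitaryGroup.arch (↥(maximalRealSubfield L)) L (IsCMField.complexConj L) N H₂,
    BorelSpace (UnitaryGroup.arch (↥(maximalRealSubfield L)) L (IsCMField.complexConj L) N H₂ ⧸
      Subgroup.centralizer ({γ} : Set (UnitaryGroup.arch (↥(maximalRealSubfield L)) L (IsCMField.complexConj L) N H₂)))]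

include hΦ in
/-- **`Φ^st` IS CARRIED BY `Φ` WITH THE TRANSPORTED MEASURES**: `Φ^st_H(Φ γ, a ∘ Φ⁻¹; Φ_* m) = Φ^st_{H₂}(γ, a; m)` for every family `m` of orbital measures on `U(H₂)(L ⊗ ℝ)`, every `a`
and every `γ` — print's «`f_v = f′_v ∘ ψ_v⁻¹`» with «compatible measures» (★ `stableOrbitalIntegralRel_transport`; stable conjugacy = `GL_N(L ⊗ ℝ)`-conjugacy is intertwined by the
ambient conjugation `Φ`). [cite: Rogawski1990, §14.4 p. 237; §1.7 p. 6; §4.1 (4.1.1) p. 39] [cite: Gelbart1975, §10 pp. 154–155] -/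
theorem archStableOrbitalIntegral_transport_archCongr
    (m : OrbitalMeasureFamily (UnitaryGroup.arch (↥(maximalRealSubfield L)) L (IsCMField.complexConj L) N H₂))
    (a : UnitaryGroup.arch (↥(maximalRealSubfield L)) L (IsCMField.complexConj L) N H₂ → ℂ)
    (γ : UnitaryGroup.arch (↥(maximalRealSubfield L)) L (IsCMField.complexConj L) N H₂) :
    archStableOrbitalIntegral L N H (m.transport Φ.toMulEquiv Φ.continuous Φ.symm.continuous) (a ∘ Φ.symm) (Φ γ) =
      archStableOrbitalIntegral L N H₂ m a γ := by
  have h := stableOrbitalIntegralRel_transport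
    (A := UnitaryGroup.arch (↥(maximalRealSubfield L)) L (IsCMField.complexConj L) N H)
    (B := UnitaryGroup.arch (↥(maximalRealSubfield L)) L (IsCMField.complexConj L) N H₂) Φ.toMulEquiv Φ.continuous Φ.symm.continuous
    (IsStablyConj (UnitaryGroup.conjMixed (↥(maximalRealSubfield L)) L (IsCMField.complexConj L)) (UnitaryGroup.archFormOf L N H))
    (IsStablyConj (UnitaryGroup.conjMixed (↥(maximalRealSubfield L)) L (IsCMField.complexConj L)) (UnitaryGroup.archFormOf L N H₂))
    (fun b b' => (isStablyConj_archCongr_iff L T Φ hΦ b b').symm)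
    (fun _ y y' hc => by
      have hGL : IsConj (y : GL (Fin N) (mixedSpace L)) (y' : GL (Fin N) (mixedSpace L)) :=
        (UnitaryGroup.arch (↥(maximalRealSubfield L)) L (IsCMField.complexConj L) N H).subtype.map_isConj hc
      exact ⟨fun h' => h'.trans hGL, fun h' => h'.trans hGL.symm⟩)
    (fun _ y y' hc => by
      have hGL : IsConj (y : GL (Fin N) (mixedSpace L)) (y' : GL (Fin N) (mixedSpace L)) :=
        (UnitaryGroup.arch (↥(maximalRealSubfield L)) L (IsCMField.complexConj L) N H₂).subtype.map_isConj hc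
      exact ⟨fun h' => h'.trans hGL, fun h' => h'.trans hGL.symm⟩)
    m (a ∘ Φ.symm) γ
  have hcomp : (a ∘ Φ.symm) ∘ (Φ.toMulEquiv : UnitaryGroup.arch (↥(maximalRealSubfield L)) L (IsCMField.complexConj L) N H₂ →
      UnitaryGroup.arch (↥(maximalRealSubfield L)) L (IsCMField.complexConj L) N H) = a := funext fun b => by
    show a (Φ.symm (Φ b)) = a b
    rw [ContinuousMulEquiv.symm_apply_apply]
  rw [hcomp] at h
  exact h

end Arch

/-! ## §3 (14.2.1) under congruence: the inner-form side (`↔`) and the quasi-split side (a reading) -/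

section InnerTransfer

variable (L : Type) [Field L] [NumberField L] [IsCMField L] {H H₂ : Matrix (Fin 3) (Fin 3) L} (T : GL (Fin 3) (mixedSpace L))
  (Φ : UnitaryGroup.arch (↥(maximalRealSubfield L)) L (IsCMField.complexConj L) 3 H₂ ≃ₜ* UnitaryGroup.arch (↥(maximalRealSubfield L)) L (IsCMField.complexConj L) 3 H)
  (hΦ : ∀ g : UnitaryGroup.arch (↥(maximalRealSubfield L)) L (IsCMField.complexConj L) 3 H₂,
    ((Φ g : UnitaryGroup.arch (↥(maximalRealSubfield L)) L (IsCMField.complexConj L) 3 H) : GL (Fin 3) (mixedSpace L)) = T * (g : GL (Fin 3) (mixedSpace L)) * T⁻¹)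
  [∀ γ : UnitaryGroup.arch (↥(maximalRealSubfield L)) L (IsCMField.complexConj L) 3 H,
    MeasurableSpace (UnitaryGroup.arch (↥(maximalRealSubfield L)) L (IsCMField.complexConj L) 3 H ⧸
      Subgroup.centralizer ({γ} : Set (UnitaryGroup.arch (↥(maximalRealSubfield L)) L (IsCMField.complexConj L) 3 H)))]
  [∀ γ : UnitaryGroup.arch (↥(maximalRealSubfield L)) L (IsCMField.complexConj L) 3 H,
    BorelSpace (UnitaryGroup.arch (↥(maximalRealSubfield L)) L (IsCMField.complexConj L) 3 H ⧸
      Subgroup.centralizer ({γ} : Set (UnitaryGroup.arch (↥(maximalRealSubfield L)) L (IsCMField.complexConj L) 3 H)))]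
  [∀ γ : UnitaryGroup.arch (↥(maximalRealSubfield L)) L (IsCMField.complexConj L) 3 H₂,
    MeasurableSpace (UnitaryGroup.arch (↥(maximalRealSubfield L)) L (IsCMField.complexConj L) 3 H₂ ⧸
      Subgroup.centralizer ({γ} : Set (UnitaryGroup.arch (↥(maximalRealSubfield L)) L (IsCMField.complexConj L) 3 H₂)))]
  [∀ γ : UnitaryGroup.arch (↥(maximalRealSubfield L)) L (IsCMField.complexConj L) 3 H₂,
    BorelSpace (UnitaryGroup.arch (↥(maximalRealSubfield L)) L (IsCMField.complexConj L) 3 H₂ ⧸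
      Subgroup.centralizer ({γ} : Set (UnitaryGroup.arch (↥(maximalRealSubfield L)) L (IsCMField.complexConj L) 3 H₂)))]
  [∀ γ : UnitaryGroup.arch (↥(maximalRealSubfield L)) L (IsCMField.complexConj L) 3 (Matrix.of fun i j : Fin 3 => if i.val + j.val + 1 = 3 then (1 : L) else 0),
    MeasurableSpace (UnitaryGroup.arch (↥(maximalRealSubfield L)) L (IsCMField.complexConj L) 3 (Matrix.of fun i j : Fin 3 => if i.val + j.val + 1 = 3 then (1 : L) else 0) ⧸
      Subgroup.centralizer ({γ} : Set (UnitaryGroup.arch (↥(maximalRealSubfield L)) L (IsCMField.complexConj L) 3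
        (Matrix.of fun i j : Fin 3 => if i.val + j.val + 1 = 3 then (1 : L) else 0))))]

include hΦ in
/-- **(14.2.1) IS INVARIANT UNDER CONGRUENCE OF THE INNER FORM**: for `Φ : U(H₂)(L ⊗ ℝ) ≃ₜ* U(H)(L ⊗ ℝ)` acting by `g ↦ T g T⁻¹`, a family `m₂` on `U(H₂)(L ⊗ ℝ)`, a family `m` on the quasi-split
`U(Φ₃)(L ⊗ ℝ)` and functions `a₂`, `a`: `IsArchInnerTransfer L H (Φ_* m₂) m (a₂ ∘ Φ⁻¹) a ↔ IsArchInnerTransfer L H₂ m₂ m a₂ a` — the pair «`f′_∞` on `U(H₂)`, `f_∞` on `U(Φ₃)`» matches iff the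
transported pair does, with the transported («compatible») measures.  ARCH twin of ★ `isLocalInnerTransfer_transport`; §1 `isInnerTransferRel_transport_left_iff` + §2.
[cite: Rogawski1990, §14.2 (14.2.1) p. 232; §14.4 p. 237; §1.7 p. 6] -/
theorem isArchInnerTransfer_transport_left_iff
    (m₂ : OrbitalMeasureFamily (UnitaryGroup.arch (↥(maximalRealSubfield L)) L (IsCMField.complexConj L) 3 H₂))
    (m : OrbitalMeasureFamily (UnitaryGroup.arch (↥(maximalRealSubfield L)) L (IsCMField.complexConj L) 3
      (Matrix.of fun i j : Fin 3 => if i.val + j.val + 1 = 3 then (1 : L) else 0)))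
    (a₂ : UnitaryGroup.arch (↥(maximalRealSubfield L)) L (IsCMField.complexConj L) 3 H₂ → ℂ)
    (a : UnitaryGroup.arch (↥(maximalRealSubfield L)) L (IsCMField.complexConj L) 3 (Matrix.of fun i j : Fin 3 => if i.val + j.val + 1 = 3 then (1 : L) else 0) → ℂ) :
    IsArchInnerTransfer L H (m₂.transport Φ.toMulEquiv Φ.continuous Φ.symm.continuous) m (a₂ ∘ Φ.symm) a ↔ IsArchInnerTransfer L H₂ m₂ m a₂ a := by
  have h := isInnerTransferRel_transport_left_iff
    (A := UnitaryGroup.arch (↥(maximalRealSubfield L)) L (IsCMField.complexConj L) 3 (Matrix.of fun i j : Fin 3 => if i.val + j.val + 1 = 3 then (1 : L) else 0))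
    (B := UnitaryGroup.arch (↥(maximalRealSubfield L)) L (IsCMField.complexConj L) 3 H)
    (B₂ := UnitaryGroup.arch (↥(maximalRealSubfield L)) L (IsCMField.complexConj L) 3 H₂) Φ.toMulEquiv Φ.continuous Φ.symm.continuous
    (Corresponds (UnitaryGroup.conjMixed (↥(maximalRealSubfield L)) L (IsCMField.complexConj L)) (UnitaryGroup.archFormOf L 3 H)
      (UnitaryGroup.archFormOf L 3 (Matrix.of fun i j : Fin 3 => if i.val + j.val + 1 = 3 then (1 : L) else 0)))
    (IsStablyConj (UnitaryGroup.conjMixed (↥(maximalRealSubfield L)) L (IsCMField.complexConj L)) (UnitaryGroup.archFormOf L 3 H))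
    (IsStablyConj (UnitaryGroup.conjMixed (↥(maximalRealSubfield L)) L (IsCMField.complexConj L)) (UnitaryGroup.archFormOf L 3 H₂))
    (IsStablyConj (UnitaryGroup.conjMixed (↥(maximalRealSubfield L)) L (IsCMField.complexConj L))
      (UnitaryGroup.archFormOf L 3 (Matrix.of fun i j : Fin 3 => if i.val + j.val + 1 = 3 then (1 : L) else 0)))
    (fun γ => IsRegularElt (γ.val : GL (Fin 3) (mixedSpace L)))
    (fun b b' => (isStablyConj_archCongr_iff L T Φ hΦ b b').symm)
    (fun _ y y' hc => by
      have hGL : IsConj (y : GL (Fin 3) (mixedSpace L)) (y' : GL (Fin 3) (mixedSpace L)) :=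
        (UnitaryGroup.arch (↥(maximalRealSubfield L)) L (IsCMField.complexConj L) 3 H).subtype.map_isConj hc
      exact ⟨fun h' => h'.trans hGL, fun h' => h'.trans hGL.symm⟩)
    (fun _ y y' hc => by
      have hGL : IsConj (y : GL (Fin 3) (mixedSpace L)) (y' : GL (Fin 3) (mixedSpace L)) :=
        (UnitaryGroup.arch (↥(maximalRealSubfield L)) L (IsCMField.complexConj L) 3 H₂).subtype.map_isConj hc
      exact ⟨fun h' => h'.trans hGL, fun h' => h'.trans hGL.symm⟩)
    m₂ m a₂ a
  have hcorr : (fun (b₂ : UnitaryGroup.arch (↥(maximalRealSubfield L)) L (IsCMField.complexConj L) 3 H₂)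
      (a : UnitaryGroup.arch (↥(maximalRealSubfield L)) L (IsCMField.complexConj L) 3 (Matrix.of fun i j : Fin 3 => if i.val + j.val + 1 = 3 then (1 : L) else 0)) =>
        Corresponds (UnitaryGroup.conjMixed (↥(maximalRealSubfield L)) L (IsCMField.complexConj L)) (UnitaryGroup.archFormOf L 3 H)
          (UnitaryGroup.archFormOf L 3 (Matrix.of fun i j : Fin 3 => if i.val + j.val + 1 = 3 then (1 : L) else 0)) (Φ.toMulEquiv b₂) a) =
      Corresponds (UnitaryGroup.conjMixed (↥(maximalRealSubfield L)) L (IsCMField.complexConj L)) (UnitaryGroup.archFormOf L 3 H₂)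
        (UnitaryGroup.archFormOf L 3 (Matrix.of fun i j : Fin 3 => if i.val + j.val + 1 = 3 then (1 : L) else 0)) := by
    funext b₂ a
    exact propext (corresponds_archCongr_left_iff L T Φ hΦ b₂ a)
  rw [hcorr] at h
  exact h

omit Φ hΦ
  [∀ γ : UnitaryGroup.arch (↥(maximalRealSubfield L)) L (IsCMField.complexConj L) 3 H,
    BorelSpace (UnitaryGroup.arch (↥(maximalRealSubfield L)) L (IsCMField.complexConj L) 3 H ⧸
      Subgroup.centralizer ({γ} : Set (UnitaryGroup.arch (↥(maximalRealSubfield L)) L (IsCMField.complexConj L) 3 H)))]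
  [∀ γ : UnitaryGroup.arch (↥(maximalRealSubfield L)) L (IsCMField.complexConj L) 3 H₂,
    MeasurableSpace (UnitaryGroup.arch (↥(maximalRealSubfield L)) L (IsCMField.complexConj L) 3 H₂ ⧸
      Subgroup.centralizer ({γ} : Set (UnitaryGroup.arch (↥(maximalRealSubfield L)) L (IsCMField.complexConj L) 3 H₂)))]
  [∀ γ : UnitaryGroup.arch (↥(maximalRealSubfield L)) L (IsCMField.complexConj L) 3 H₂,
    BorelSpace (UnitaryGroup.arch (↥(maximalRealSubfield L)) L (IsCMField.complexConj L) 3 H₂ ⧸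
      Subgroup.centralizer ({γ} : Set (UnitaryGroup.arch (↥(maximalRealSubfield L)) L (IsCMField.complexConj L) 3 H₂)))] in
/-- **THE QUASI-SPLIT SIDE READ ON A CONGRUENT CARRIER**: (14.2.1) is typed with `U(Φ₃)(L ⊗ ℝ)` FIXED; for any `Φ_A : U(Φ₃)(L ⊗ ℝ) ≃ₜ* U(H_A)(L ⊗ ℝ)` acting by `g ↦ T_A g T_A⁻¹` (FILE 1: the inverse
of the quasi-split term onto `U(diag(½,1,−½))(L ⊗ ℝ)`), `IsArchInnerTransfer L H m′ m a′ a` gives, at every REGULAR `δ ∈ U(H_A)(L ⊗ ℝ)` and every `γ′ ∈ U(H)(L ⊗ ℝ)` with `γ′ ↔ δ`,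
`Φ^st_{H_A}(δ, a ∘ Φ_A⁻¹; (Φ_A)_* m) = Φ^st_{H}(γ′, a′; m′)` — both stable orbital integrals the (L-use) junction differentiates are now available on diagonal-form carriers.
[cite: Rogawski1990, §14.2 (14.2.1) p. 232; §14.4 p. 237; §14.5 p. 238] -/
theorem archStableOrbitalIntegral_transport_eq_of_isArchInnerTransfer {H_A : Matrix (Fin 3) (Fin 3) L} (T_A : GL (Fin 3) (mixedSpace L))
    (Φ_A : UnitaryGroup.arch (↥(maximalRealSubfield L)) L (IsCMField.complexConj L) 3 (Matrix.of fun i j : Fin 3 => if i.val + j.val + 1 = 3 then (1 : L) else 0) ≃ₜ*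
      UnitaryGroup.arch (↥(maximalRealSubfield L)) L (IsCMField.complexConj L) 3 H_A)
    (hΦ_A : ∀ g, ((Φ_A g : UnitaryGroup.arch (↥(maximalRealSubfield L)) L (IsCMField.complexConj L) 3 H_A) : GL (Fin 3) (mixedSpace L)) =
      T_A * (g : GL (Fin 3) (mixedSpace L)) * T_A⁻¹)
    [∀ γ : UnitaryGroup.arch (↥(maximalRealSubfield L)) L (IsCMField.complexConj L) 3 (Matrix.of fun i j : Fin 3 => if i.val + j.val + 1 = 3 then (1 : L) else 0),
      BorelSpace (UnitaryGroup.arch (↥(maximalRealSubfield L)) L (IsCMField.complexConj L) 3 (Matrix.of fun i j : Fin 3 => if i.val + j.val + 1 = 3 then (1 : L) else 0) ⧸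
        Subgroup.centralizer ({γ} : Set (UnitaryGroup.arch (↥(maximalRealSubfield L)) L (IsCMField.complexConj L) 3
          (Matrix.of fun i j : Fin 3 => if i.val + j.val + 1 = 3 then (1 : L) else 0))))]
    [∀ γ : UnitaryGroup.arch (↥(maximalRealSubfield L)) L (IsCMField.complexConj L) 3 H_A,
      MeasurableSpace (UnitaryGroup.arch (↥(maximalRealSubfield L)) L (IsCMField.complexConj L) 3 H_A ⧸
        Subgroup.centralizer ({γ} : Set (UnitaryGroup.arch (↥(maximalRealSubfield L)) L (IsCMField.complexConj L) 3 H_A)))]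
    [∀ γ : UnitaryGroup.arch (↥(maximalRealSubfield L)) L (IsCMField.complexConj L) 3 H_A,
      BorelSpace (UnitaryGroup.arch (↥(maximalRealSubfield L)) L (IsCMField.complexConj L) 3 H_A ⧸
        Subgroup.centralizer ({γ} : Set (UnitaryGroup.arch (↥(maximalRealSubfield L)) L (IsCMField.complexConj L) 3 H_A)))]
    {m' : OrbitalMeasureFamily (UnitaryGroup.arch (↥(maximalRealSubfield L)) L (IsCMField.complexConj L) 3 H)}
    {m : OrbitalMeasureFamily (UnitaryGroup.arch (↥(maximalRealSubfield L)) L (IsCMField.complexConj L) 3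
      (Matrix.of fun i j : Fin 3 => if i.val + j.val + 1 = 3 then (1 : L) else 0))}
    {a' : UnitaryGroup.arch (↥(maximalRealSubfield L)) L (IsCMField.complexConj L) 3 H → ℂ}
    {a : UnitaryGroup.arch (↥(maximalRealSubfield L)) L (IsCMField.complexConj L) 3 (Matrix.of fun i j : Fin 3 => if i.val + j.val + 1 = 3 then (1 : L) else 0) → ℂ}
    (h : IsArchInnerTransfer L H m' m a' a) (γ' : UnitaryGroup.arch (↥(maximalRealSubfield L)) L (IsCMField.complexConj L) 3 H)
    (δ : UnitaryGroup.arch (↥(maximalRealSubfield L)) L (IsCMField.complexConj L) 3 H_A) (hδ : IsRegularElt (δ : GL (Fin 3) (mixedSpace L)))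
    (hc : Corresponds (UnitaryGroup.conjMixed (↥(maximalRealSubfield L)) L (IsCMField.complexConj L)) (UnitaryGroup.archFormOf L 3 H) (UnitaryGroup.archFormOf L 3 H_A) γ' δ) :
    archStableOrbitalIntegral L 3 H_A (m.transport Φ_A.toMulEquiv Φ_A.continuous Φ_A.symm.continuous) (a ∘ Φ_A.symm) δ =
      archStableOrbitalIntegral L 3 H m' a' γ' := by
  obtain ⟨γ, rfl⟩ : ∃ γ, Φ_A γ = δ := ⟨Φ_A.symm δ, Φ_A.apply_symm_apply δ⟩
  rw [archStableOrbitalIntegral_transport_archCongr L T_A Φ_A hΦ_A m a γ]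
  have hreg : IsRegularElt (γ : GL (Fin 3) (mixedSpace L)) := (isRegularElt_coe_archCongr_iff L T_A Φ_A hΦ_A γ).1 hδ
  have hc' : Corresponds (UnitaryGroup.conjMixed (↥(maximalRealSubfield L)) L (IsCMField.complexConj L)) (UnitaryGroup.archFormOf L 3 H)
      (UnitaryGroup.archFormOf L 3 (Matrix.of fun i j : Fin 3 => if i.val + j.val + 1 = 3 then (1 : L) else 0)) γ' γ :=
    (corresponds_archCongr_right_iff L T_A Φ_A hΦ_A γ' γ).1 hc
  exact (h γ hreg).1 γ' hc'

end InnerTransfer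

end Literature.NumberTheory.Rogawski1990

end
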